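import Literature.Combinatorics.Sahi2008.LebesgueSquare
import Literature.Probability.LatticeModels.MTP2FourFunctionsUnitSquare
import Summits.CriticalPhenomena.PercolationContinuityZ3.Theorems.PercNearOneGluingNoHeavyLowerTailSahiTwoDimFKG

/-!
# `NoHeavyLowerTail` (crux stmt-CriticalPhenomena-4575), Sahi programme: Sahi's conjecture of EVERY order for
# EVERY absolutely continuous FKG probability measure on the unit square (continuum form of the 2-D theorem)

Support file (Sahi cell, typer seat, generation 5; `--supports stmt-CriticalPhenomena-4575`).

Lieb–Sahi [LiebSahi2021, Thm. 3.7] prove `E_n(f_1,…,f_n) ≥ 0` for all `n` on `[0,1]²` with LEBESGUE measure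
(tree: `Literature.Combinatorics.Sahi2008.liebSahi_thm37`); their introduction recalls that the FKG inequality holds
"more generally for any absolutely continuous measure whose density function satisfies (sup-mod)".  The Sahi
programme's P1 proved the DISCRETE two-dimensional case of Sahi's conjecture for every FKG weight on a product
of two finite chains (`SahiTwoDim.sahiPositive_of_isFKGMeasure_prod`).  Here is its continuum form:

**Theorem** (`mSahiPositive_withDensity`).  Let `ρ : [0,1]² → [0,∞]` be measurable, bounded, log-supermodular
(`ρ(p)ρ(q) ≤ ρ(p ∨ q)ρ(p ∧ q)`), with `∫ ρ dλ = 1`.  Then the probability measure `ρ·λ` on `[0,1]²` is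
Sahi-positive of every order: `E_n(f_0,…,f_{n−1}) ≥ 0` for all `n` and all nonnegative monotone (increasing)
`f_i : [0,1]² → ℝ`; likewise for monotone decreasing families (`msahiE_withDensity_nonneg_of_antitone`).
New mathematics, not in print (Lieb–Sahi treat `ρ ≡ 1`).

Proof.  (`mSahiPositive_of_cellWeights`, a criterion for an arbitrary probability measure `μ` on the square.)
For the `(m+1) × (m+1)` grid let `w_m(c) = μ(cell c)`.  If every `w_m` is an FKG weight on the grid
`Fin (m+1) × Fin (m+1)` and `w_m(c) ≤ R·λ(cell c)`, then for monotone `g` the weighted Riemann sums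
`Σ_c w_m(c) g(c⁻) ≤ ∫ g dμ ≤ Σ_c w_m(c) g(c⁺)` differ by `≤ 2R(g(1,1) − g(0,0))/(m+1)`
(`Literature…LebesgueSquare.sum_weight_mul_sub_le`), so the joint moments of the grid family
`(a,b) ↦ f_i(a/(m+1), b/(m+1))` under `w_m` converge to those of `f` under `μ`; `E_n` is a continuous polynomial in
the joint moments (`momentE`), and `E_n^{w_m} ≥ 0` by P1's theorem.  For `μ = ρ·λ` the cell weights are FKG by the
continuous four functions theorem on the square (`Literature…lintegral_four_functions_unitSquare`, applied to
`ρ·1_{cell c}, ρ·1_{cell d}, ρ·1_{cell c∨d}, ρ·1_{cell c∧d}` — the cell map is a lattice homomorphism), and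
`w_m(c) ≤ (sup ρ)·λ(cell c)`.
-/

noncomputable section

namespace Summit.CriticalPhenomena.PercolationContinuityZ3.Theorems.SahiTwoDimDensity

open Finset Function MeasureTheory Set Filter Topology
open Literature.Combinatorics.Sahi2008 Literature.Combinatorics.Sahi2008.LebesgueSquare
open scoped unitInterval ENNReal NNReal

variable {m : ℕ}

/-! ## Cell weights of a measure on the square -/

/-- The cell weights `w_m(c) = μ(cell c)` of a measure on `[0,1]²` for the `(m+1) × (m+1)` grid. [this work] -/
def cellWeight (μ : Measure (I × I)) (m : ℕ) : Fin (m + 1) × Fin (m + 1) → ℝ :=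
  fun c => μ.real (cellPair m ⁻¹' {c})

/-- Cell weights are nonnegative. [this work] -/
theorem cellWeight_nonneg (μ : Measure (I × I)) (c : Fin (m + 1) × Fin (m + 1)) : 0 ≤ cellWeight μ m c :=
  measureReal_nonneg

/-- The cell weights of a probability measure sum to one. [this work] -/
theorem sum_cellWeight (μ : Measure (I × I)) [IsProbabilityMeasure μ] : ∑ c, cellWeight μ m c = 1 := by
  unfold cellWeight
  rw [sum_measureReal_preimage_singleton univ
    (fun c _ => (cellPair_measurable m) (measurableSet_singleton c)), coe_univ, Set.preimage_univ,
    probReal_univ]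

/-- `E_w(γ) = ∫ γ(cell p) dμ(p)`: expectations under the cell weights are integrals of grid step functions.
[this work] -/
theorem ex_cellWeight (μ : Measure (I × I)) [IsFiniteMeasure μ] (γ : Fin (m + 1) × Fin (m + 1) → ℝ) :
    ex (cellWeight μ m) γ = ∫ p, γ (cellPair m p) ∂μ := by
  rw [integral_comp_cellPair_measure, ex]
  rfl

/-! ## The weighted sandwich -/

/-- Lower sandwich: `Σ_c w(c) g(c⁻) ≤ ∫ g dμ` for a monotone `μ`-integrable `g`. [this work] -/
theorem ex_loCorner_le_integral (μ : Measure (I × I)) [IsFiniteMeasure μ] {g : I × I → ℝ} (hg : Monotone g)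
    (hgi : Integrable g μ) : ex (cellWeight μ m) (g ∘ loCorner m) ≤ ∫ p, g p ∂μ := by
  rw [ex_cellWeight]
  exact integral_mono (integrable_comp_cellPair_measure μ _) hgi fun p => hg (loCorner_le p)

/-- Upper sandwich: `∫ g dμ ≤ Σ_c w(c) g(c⁺)`. [this work] -/
theorem integral_le_ex_hiCorner (μ : Measure (I × I)) [IsFiniteMeasure μ] {g : I × I → ℝ} (hg : Monotone g)
    (hgi : Integrable g μ) : ∫ p, g p ∂μ ≤ ex (cellWeight μ m) (g ∘ hiCorner m) := by
  rw [ex_cellWeight]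
  exact integral_mono hgi (integrable_comp_cellPair_measure μ _) fun p => hg (le_hiCorner p)

/-- The sandwich closes when the cell weights are dominated by `R`·Lebesgue:
`Σ_c w(c)(g(c⁺) − g(c⁻)) ≤ 2R(g(1,1) − g(0,0))/(m+1)`. [this work] -/
theorem ex_hiCorner_sub_ex_loCorner_le (μ : Measure (I × I)) {g : I × I → ℝ} (hg : Monotone g) {R : ℝ}
    (hR : ∀ c : Fin (m + 1) × Fin (m + 1), cellWeight μ m c ≤ R * LiebSahiGrid.gridWeight (m + 1) c) :
    ex (cellWeight μ m) (g ∘ hiCorner m) - ex (cellWeight μ m) (g ∘ loCorner m) ≤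
      2 * R * (g (1, 1) - g (0, 0)) / ((m : ℝ) + 1) := by
  have hm : (0 : ℝ) < (m : ℝ) + 1 := by positivity
  have hdiff : ex (cellWeight μ m) (g ∘ hiCorner m) - ex (cellWeight μ m) (g ∘ loCorner m) =
      ∑ c, cellWeight μ m c * (g (hiCorner m c) - g (loCorner m c)) := by
    rw [ex, ex, ← sum_sub_distrib]
    exact sum_congr rfl fun c _ => by simp only [Function.comp_apply]; ring
  have hW : ∀ c : Fin (m + 1) × Fin (m + 1), cellWeight μ m c ≤ R / (((m + 1 : ℕ) : ℝ)) ^ 2 := by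
    intro c
    have h := hR c
    simp only [LiebSahiGrid.gridWeight] at h
    rwa [mul_one_div] at h
  rw [hdiff]
  refine (sum_weight_mul_sub_le hg _ (fun c => cellWeight_nonneg μ c) hW).trans (le_of_eq ?_)
  push_cast
  field_simp

/-! ## From FKG cell weights to Sahi positivity of the measure -/

/-- A finite product of nonnegative monotone real functions is monotone (plumbing). [this work] -/
private theorem monotone_finset_prod {β : Type*} [Preorder β] {n : ℕ} {f : Fin n → β → ℝ}
    (hf0 : ∀ i x, 0 ≤ f i x) (hmono : ∀ i, Monotone (f i)) (S : Finset (Fin n)) :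
    Monotone (∏ i ∈ S, f i) := by
  classical
  induction S using Finset.induction_on with
  | empty =>
    rw [Finset.prod_empty]
    exact monotone_const
  | insert a S ha ih =>
    rw [Finset.prod_insert ha]
    exact (hmono a).mul ih (hf0 a) fun x => by
      rw [Finset.prod_apply]; exact prod_nonneg fun i _ => hf0 i x

/-- A monotone function on the square is integrable for every probability measure absolutely continuous with
respect to Lebesgue measure (bounded, a.e. Borel). [this work] -/
theorem integrable_of_monotone_of_absolutelyContinuous (μ : Measure (I × I)) [IsFiniteMeasure μ]
    (hμ : μ ≪ volume) {g : I × I → ℝ} (hg : Monotone g) : Integrable g μ := by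
  refine Integrable.mono' (integrable_const (|g (0, 0)| + |g (1, 1)|))
    (hg.aestronglyMeasurable_unitSquare.mono_ac hμ) (Eventually.of_forall fun p => ?_)
  rw [Real.norm_eq_abs]
  have h0 : ((0 : I), (0 : I)) ≤ p :=
    ⟨Subtype.coe_le_coe.1 (by rw [Set.Icc.coe_zero]; exact p.1.2.1),
      Subtype.coe_le_coe.1 (by rw [Set.Icc.coe_zero]; exact p.2.2.1)⟩
  have h1 : p ≤ ((1 : I), (1 : I)) :=
    ⟨Subtype.coe_le_coe.1 (by rw [Set.Icc.coe_one]; exact p.1.2.2),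
      Subtype.coe_le_coe.1 (by rw [Set.Icc.coe_one]; exact p.2.2.2)⟩
  have hl := hg h0
  have hu := hg h1
  rcases le_total 0 (g p) with h | h
  · rw [abs_of_nonneg h]
    linarith [le_abs_self (g (1, 1)), abs_nonneg (g (0, 0))]
  · rw [abs_of_nonpos h]
    linarith [neg_abs_le (g (0, 0)), abs_nonneg (g (1, 1))]

/-- **The joint moments of the grid family under the cell weights converge to the joint moments under `μ`**
(cell weights dominated by `R`·Lebesgue, `μ ≪ λ`). [this work] -/
theorem tendsto_gridMoment (μ : Measure (I × I)) [IsProbabilityMeasure μ] (hμ : μ ≪ volume) {R : ℝ}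
    (hR : ∀ m (c : Fin (m + 1) × Fin (m + 1)), cellWeight μ m c ≤ R * LiebSahiGrid.gridWeight (m + 1) c)
    {n : ℕ} {f : Fin n → I × I → ℝ} (hf0 : ∀ i x, 0 ≤ f i x) (hmono : ∀ i, Monotone (f i))
    (S : Finset (Fin n)) :
    Tendsto (fun m => ex (cellWeight μ m) (∏ i ∈ S, gridFam m f i)) atTop
      (𝓝 (∫ p, (∏ i ∈ S, f i) p ∂μ)) := by
  set g : I × I → ℝ := ∏ i ∈ S, f i with hgdef
  have hg : Monotone g := monotone_finset_prod hf0 hmono S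
  have hgi : Integrable g μ := integrable_of_monotone_of_absolutelyContinuous μ hμ hg
  have hlo : ∀ m, ex (cellWeight μ m) (∏ i ∈ S, gridFam m f i) = ex (cellWeight μ m) (g ∘ loCorner m) := by
    intro m
    congr 1
    funext c
    simp only [Finset.prod_apply, Function.comp_apply, gridFam, hgdef]
  simp only [hlo]
  set B : ℝ := g (1, 1) - g (0, 0) with hB
  have hlim0 : Tendsto (fun m : ℕ => (∫ p, g p ∂μ) - 2 * R * B / ((m : ℝ) + 1)) atTop (𝓝 (∫ p, g p ∂μ)) := by
    have h := (tendsto_const_div_atTop_nhds_zero_nat (2 * R * B)).comp (tendsto_add_atTop_nat 1)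
    have h' : Tendsto (fun m : ℕ => 2 * R * B / ((m : ℝ) + 1)) atTop (𝓝 0) := by
      refine h.congr fun m => ?_
      simp only [Function.comp_apply, Nat.cast_add, Nat.cast_one]
    simpa using (tendsto_const_nhds (x := ∫ p, g p ∂μ)).sub h'
  refine tendsto_of_tendsto_of_tendsto_of_le_of_le hlim0 tendsto_const_nhds (fun m => ?_) fun m => ?_
  · have h1 := integral_le_ex_hiCorner (m := m) μ hg hgi
    have h2 := ex_hiCorner_sub_ex_loCorner_le (m := m) μ hg (hR m)
    linarith
  · exact ex_loCorner_le_integral μ hg hgi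

/-- **Criterion.** A probability measure `μ ≪ λ` on `[0,1]²` whose cell weights are an FKG weight on every grid
`Fin (m+1) × Fin (m+1)` and are dominated by `R`·Lebesgue is Sahi-positive of every order — by P1's discrete
two-dimensional theorem `SahiTwoDim.sahiPositive_of_isFKGMeasure_prod` on each grid and the continuity of the
moment polynomial. [this work] -/
theorem mSahiPositive_of_cellWeights (μ : Measure (I × I)) [IsProbabilityMeasure μ] (hμ : μ ≪ volume)
    (hFKG : ∀ m, IsFKGMeasure (cellWeight μ m)) {R : ℝ}
    (hR : ∀ m (c : Fin (m + 1) × Fin (m + 1)), cellWeight μ m c ≤ R * LiebSahiGrid.gridWeight (m + 1) c)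
    (n : ℕ) : MSahiPositive μ n := by
  intro f hf0 hmono
  set M : Finset (Fin n) → ℝ := fun S => ∫ p, (∏ i ∈ S, f i) p ∂μ with hM
  have hE : msahiE μ n f = momentE n M := msahiE_eq_momentE _ n f
  have hlim : Tendsto (fun m => momentE n fun S => ex (cellWeight μ m) (∏ i ∈ S, gridFam m f i))
      atTop (𝓝 (momentE n M)) :=
    ((continuous_momentE n).tendsto M).comp (tendsto_pi_nhds.2 fun S => tendsto_gridMoment μ hμ hR hf0 hmono S)
  have hpos : ∀ m, 0 ≤ momentE n fun S => ex (cellWeight μ m) (∏ i ∈ S, gridFam m f i) := by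
    intro m
    rw [← sahiE_eq_momentE]
    exact SahiTwoDim.sahiPositive_of_isFKGMeasure_prod (hFKG m) n _ (gridFam_nonneg hf0 m)
      (gridFam_monotone hmono m)
  rw [hE]
  exact ge_of_tendsto' hlim hpos

/-! ## Absolutely continuous FKG measures: the cell weights of a log-supermodular density are FKG -/

/-- The density restricted to a cell (plumbing). [this work] -/
private def cellDensity (ρ : I × I → ℝ≥0∞) (m : ℕ) (c : Fin (m + 1) × Fin (m + 1)) : I × I → ℝ≥0∞ :=
  (cellPair m ⁻¹' {c}).indicator ρ

/-- Cells are measurable (plumbing). [this work] -/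
private theorem measurableSet_cell (c : Fin (m + 1) × Fin (m + 1)) : MeasurableSet (cellPair m ⁻¹' {c}) :=
  (cellPair_measurable m) (measurableSet_singleton c)

/-- The mass of a cell under `ρ·λ` is the Lebesgue integral of the cell density (plumbing). [this work] -/
private theorem withDensity_cell (ρ : I × I → ℝ≥0∞) (c : Fin (m + 1) × Fin (m + 1)) :
    volume.withDensity ρ (cellPair m ⁻¹' {c}) = ∫⁻ p, cellDensity ρ m c p ∂volume := by
  rw [withDensity_apply ρ (measurableSet_cell c), cellDensity, lintegral_indicator (measurableSet_cell c)]

/-- **The cell weights of a log-supermodular density are an FKG weight** on every grid: the four functions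
theorem on the square applied to `ρ·1_{cell c}`, `ρ·1_{cell d}`, `ρ·1_{cell c∨d}`, `ρ·1_{cell c∧d}` (the cell map is a
lattice homomorphism `[0,1]² → Fin (m+1)²`). [this work] -/
theorem isFKGMeasure_cellWeight_withDensity (ρ : I × I → ℝ≥0∞) (hρm : Measurable ρ)
    (hρ : ∀ p q, ρ p * ρ q ≤ ρ (p ⊔ q) * ρ (p ⊓ q)) [IsProbabilityMeasure (volume.withDensity ρ)] (m : ℕ) :
    IsFKGMeasure (cellWeight (volume.withDensity ρ) m) where
  nonneg c := cellWeight_nonneg _ c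
  sum_eq_one := sum_cellWeight _
  mul_le_mul c d := by
    have hmeas : ∀ e : Fin (m + 1) × Fin (m + 1), Measurable (cellDensity ρ m e) := fun e =>
      hρm.indicator (measurableSet_cell e)
    have key := Literature.Probability.LatticeModels.lintegral_four_functions_unitSquare
      (cellDensity ρ m c) (cellDensity ρ m d) (cellDensity ρ m (c ⊔ d)) (cellDensity ρ m (c ⊓ d))
      (hmeas c) (hmeas d) (hmeas _) (hmeas _) (fun p q => by
        unfold cellDensity
        by_cases hp : p ∈ cellPair m ⁻¹' {c}
        · by_cases hq : q ∈ cellPair m ⁻¹' {d}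
          · have hp' : cellPair m p = c := hp
            have hq' : cellPair m q = d := hq
            have hsup : p ⊔ q ∈ cellPair m ⁻¹' {c ⊔ d} := by
              show cellPair m (p ⊔ q) = c ⊔ d
              rw [cellPair_sup, hp', hq']
            have hinf : p ⊓ q ∈ cellPair m ⁻¹' {c ⊓ d} := by
              show cellPair m (p ⊓ q) = c ⊓ d
              rw [cellPair_inf, hp', hq']
            rw [indicator_of_mem hp, indicator_of_mem hq, indicator_of_mem hsup, indicator_of_mem hinf]
            exact hρ p q
          · rw [indicator_of_notMem hq, mul_zero]
            exact bot_le
        · rw [indicator_of_notMem hp, zero_mul]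
          exact bot_le)
    have hfin : ∀ e : Fin (m + 1) × Fin (m + 1), ∫⁻ p, cellDensity ρ m e p ∂volume ≠ ∞ := fun e => by
      rw [← withDensity_cell]
      exact measure_ne_top _ _
    unfold cellWeight
    simp only [measureReal_def, withDensity_cell]
    rw [← ENNReal.toReal_mul, ← ENNReal.toReal_mul, mul_comm (∫⁻ p, cellDensity ρ m (c ⊓ d) p ∂volume)]
    exact ENNReal.toReal_mono (ENNReal.mul_ne_top (hfin _) (hfin _)) key

/-- The cell weights of a bounded density are dominated by `(sup ρ)`·Lebesgue. [this work] -/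
theorem cellWeight_withDensity_le (ρ : I × I → ℝ≥0∞) {R : ℝ≥0} (hρR : ∀ p, ρ p ≤ R) (m : ℕ)
    (c : Fin (m + 1) × Fin (m + 1)) :
    cellWeight (volume.withDensity ρ) m c ≤ (R : ℝ) * LiebSahiGrid.gridWeight (m + 1) c := by
  unfold cellWeight
  rw [← volume_real_cell c, measureReal_def, measureReal_def]
  have h : volume.withDensity ρ (cellPair m ⁻¹' {c}) ≤ (R : ℝ≥0∞) * volume (cellPair m ⁻¹' {c}) := by
    rw [withDensity_apply ρ (measurableSet_cell c), ← setLIntegral_const]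
    exact setLIntegral_mono measurable_const fun p _ => hρR p
  have h' := ENNReal.toReal_mono (ENNReal.mul_ne_top ENNReal.coe_ne_top (measure_ne_top _ _)) h
  rwa [ENNReal.toReal_mul, ENNReal.coe_toReal] at h'

/-- **Every absolutely continuous FKG probability measure on the unit square is Sahi-positive of every order.**
For a measurable, bounded, log-supermodular density `ρ` on `[0,1]²` with `∫ ρ dλ = 1`, the measure `ρ·λ`
satisfies `E_n(f_0,…,f_{n−1}) ≥ 0` for every `n` and all nonnegative monotone increasing `f_i : [0,1]² → ℝ`
(Lieb–Sahi's Theorem 3.7 is `ρ ≡ 1`).  New mathematics: the continuum form of P1's two-dimensional theorem.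
[this work] -/
theorem mSahiPositive_withDensity (ρ : I × I → ℝ≥0∞) (hρm : Measurable ρ) {R : ℝ≥0} (hρR : ∀ p, ρ p ≤ R)
    (hρ : ∀ p q, ρ p * ρ q ≤ ρ (p ⊔ q) * ρ (p ⊓ q)) [IsProbabilityMeasure (volume.withDensity ρ)] (n : ℕ) :
    MSahiPositive (volume.withDensity ρ) n :=
  mSahiPositive_of_cellWeights _ (withDensity_absolutelyContinuous _ _)
    (isFKGMeasure_cellWeight_withDensity ρ hρm hρ) (cellWeight_withDensity_le ρ hρR) n

/-- The central reflection `(x,y) ↦ (1−x,1−y)` (plumbing). [this work] -/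
private def refl : I × I → I × I := Prod.map unitInterval.symm unitInterval.symm

/-- The reflection is an involution (plumbing). [this work] -/
private theorem refl_refl (p : I × I) : refl (refl p) = p :=
  Prod.ext (unitInterval.symm_symm p.1) (unitInterval.symm_symm p.2)

/-- The reflection turns `⊔` into `⊓` (plumbing). [this work] -/
private theorem refl_sup (p q : I × I) : refl (p ⊔ q) = refl p ⊓ refl q :=
  have h : Antitone unitInterval.symm := fun _ _ hab => unitInterval.symm_le_symm.2 hab
  Prod.ext (h.map_sup p.1 q.1) (h.map_sup p.2 q.2)

/-- The reflection turns `⊓` into `⊔` (plumbing). [this work] -/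
private theorem refl_inf (p q : I × I) : refl (p ⊓ q) = refl p ⊔ refl q :=
  have h : Antitone unitInterval.symm := fun _ _ hab => unitInterval.symm_le_symm.2 hab
  Prod.ext (h.map_inf p.1 q.1) (h.map_inf p.2 q.2)

/-- The reflection is a measurable embedding preserving Lebesgue measure (plumbing). [this work] -/
private theorem measurableEmbedding_refl : MeasurableEmbedding refl :=
  (unitInterval.symmMeasurableEquiv.prodCongr unitInterval.symmMeasurableEquiv).measurableEmbedding

/-- The reflection preserves Lebesgue measure (plumbing). [this work] -/
private theorem measurePreserving_refl : MeasurePreserving refl (volume : Measure (I × I)) volume := by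
  rw [Measure.volume_eq_prod]
  exact unitInterval.measurePreserving_symm.prod unitInterval.measurePreserving_symm

/-- The reflection pushes `(ρ ∘ refl)·λ` to `ρ·λ` (plumbing). [this work] -/
private theorem measurePreserving_refl_withDensity (ρ : I × I → ℝ≥0∞) (hρm : Measurable ρ) :
    MeasurePreserving refl (volume.withDensity (ρ ∘ refl)) (volume.withDensity ρ) := by
  refine ⟨measurableEmbedding_refl.measurable, ?_⟩
  ext s hs
  rw [Measure.map_apply measurableEmbedding_refl.measurable hs,
    withDensity_apply _ (measurableEmbedding_refl.measurable hs), withDensity_apply _ hs]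
  exact measurePreserving_refl.setLIntegral_comp_preimage hs hρm

/-- The decreasing form: nonnegative monotone DECREASING families also have `E_n ≥ 0` under `ρ·λ` (apply the
theorem to the reflected density `ρ ∘ refl`, again bounded and log-supermodular, and transport along the
measure-preserving reflection `(x,y) ↦ (1−x,1−y)`). [this work] -/
theorem msahiE_withDensity_nonneg_of_antitone (ρ : I × I → ℝ≥0∞) (hρm : Measurable ρ) {R : ℝ≥0}
    (hρR : ∀ p, ρ p ≤ R) (hρ : ∀ p q, ρ p * ρ q ≤ ρ (p ⊔ q) * ρ (p ⊓ q))
    [IsProbabilityMeasure (volume.withDensity ρ)] (n : ℕ) (f : Fin n → I × I → ℝ) (hf0 : ∀ i x, 0 ≤ f i x)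
    (hanti : ∀ i, Antitone (f i)) : 0 ≤ msahiE (volume.withDensity ρ) n f := by
  have hpush := measurePreserving_refl_withDensity ρ hρm
  haveI : IsProbabilityMeasure (volume.withDensity (ρ ∘ refl)) := by
    constructor
    have h := hpush.measure_preimage (s := Set.univ) MeasurableSet.univ.nullMeasurableSet
    rw [Set.preimage_univ] at h
    rw [h]
    exact measure_univ
  rw [← msahiE_comp_measurePreserving hpush measurableEmbedding_refl n f]
  refine mSahiPositive_withDensity (ρ ∘ refl) (hρm.comp measurableEmbedding_refl.measurable)
    (fun p => hρR _) (fun p q => ?_) n _ (fun i x => hf0 i _) fun i p q hpq => hanti i ?_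
  · simp only [Function.comp_apply, refl_sup, refl_inf]
    rw [mul_comm (ρ (refl p ⊓ refl q))]
    exact hρ (refl p) (refl q)
  · exact ⟨unitInterval.symm_le_symm.2 hpq.1, unitInterval.symm_le_symm.2 hpq.2⟩

end Summit.CriticalPhenomena.PercolationContinuityZ3.Theorems.SahiTwoDimDensity
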